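import Summits.QuantumFields.BalabanUV.Beta.FP.FarRegionSmear

/-!
# `BalabanUV.Beta.FP.FarRegionSmearGraded` — road «FP» (binder row D1), `RHOA-DESIGN.md` §3 (F-PC) ∕ §5 row RHOA-4 «FAR-REGION MOMENT», PART 2 FILE B (towards (b)):
# SCALE-`n` GRADED KERNELS READ BY A ZERO-MASS, ZERO-FIRST-MOMENT WEIGHT AT A FAR POINT `‖z‖∞ ≥ 8` — the truncated engine of `FP/FarRegionSmear` fed with the graded
# OUTER constants, every term majorised by the shape factor `Ψ_m(s) := e^{−(m/n)s}(1+s/n)²/s^{a+2}` of `FP/FarRegionMoment`, constants DISPLAYED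
# ([folklore] real analysis on `ℤ⁴`; G-an2-4 formalisation swarm, unit `b2b-balaban-gan24-formalise-leaf-06`, gen 32, cross-lane idle-seat brick)

HONEST DEPENDENCY (page 1, mandatory): continuum YM on T⁴ ⇐ BetaPertH ∧ nine spine estimates (0/9 proved); BetaPertH ⇐ (D1) ∧ (D4) ∧
CAP+tail; G-an2-4 gates asym, D1 and NE2/3/4.  HONEST FRAMING (cell contract, verbatim): «discharging `BetaPertH` makes Bałaban's UV
stability UNCONDITIONAL — a real constructive-QFT result; it is NOT the continuum limit and NOT the Clay problem.»  THIS MODULE is elementary [folklore]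
real analysis over gen-32's `FP/FarRegionSmear.abs_smear_sub_order1_le_far` and leaf-02-g6's letters `Θ_m` (`ExpLocalisedBubble`); it asserts nothing about Bałaban's
objects, cites nothing, mints no `Prop` fact, has no `def`, 0 sorry.  The GRADED data of the kernel (`|Δ^jH t| ≤ A_j‖t‖∞^{−a−j}e^{−(η/n)‖t‖∞}(1+‖t‖∞/n)^j`, `j ≤ 2` —
what products of graded legs of the H′ route are expected to satisfy: IR-5∕IR-6, H2-ASM-2, OPEN) and the weight's zero mass ∕ zero first moments (H2V vertex letters) are
HYPOTHESES displayed in the signatures.  NOT `hbook`, NOT `ρ_n = O(1)`, NOT D1, NOT BetaPertH, NOT continuum, NOT Clay; «not in print; our bookkeeping».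

CONTENT (`Θ_m := 2^{m+1}·(m!e^{δ/2}(2/δ)^m)·e^{δ/2}·Zl 4 (δ/2)²`).
* §1 real lemmas: `pow_mul_exp_neg_le` (`x^p e^{−κx} ≤ p!/κ^p`), `inv_sq_le`, the four term bounds `termB0_le` ∕ `termB1_le` ∕ `termB2_eq` ∕ `termBc_le`;
* §2 `outer0_of_graded`, `box2_of_graded` (graded data ⟹ the OUTER constants of the truncated engine at `‖z‖∞ ≥ 8`), **`abs_smear_le_of_graded_far`**:
  `|Σ' c·H(z+x−y)| ≤ K₈·Ψ_m(‖z‖∞)` for `‖z‖∞ ≥ 8`, `0 < m ≤ min(η/2, δ/8)`,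
  `K₈ := C·(20(4/3)^{a+2}(25/16)A₂Θ₂ + 128·2^a·A₀Θ₂ + 64·A₁Θ₃) + Ag·C·Zl(δ/2)²·e^{δ/4}·(a+2)!(8/δ)^{a+2}`.
The core `‖z‖∞ ≤ 8`, the uniform shape beyond the window and the chaining with `FP/FarRegionMoment` at `a = 4` are the sequel `FP/FarRegionSmearShape`.
Provenance: leaf prover 06 (gen 32), 2026-08-20∕21; no existing file touched.
-/

noncomputable section

namespace Summit.QuantumFields.BalabanUV.Beta.FP.FarRegionSmearGraded

open Finset Filter Topology fwdDiff
open scoped BigOperators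
open Literature.MathematicalPhysics.QuantumFieldTheory.Balaban1983to89
open Literature.MathematicalPhysics.QuantumFieldTheory.Balaban1983to89.Beta
open B12Sec2to5 (l1 l1_nonneg abs_coord_le_l1)
open ExpKernelCalculus (Site Zl Zl_pos)
open DyadicShell (Pt supNorm natAbs_le_supNorm supNorm_le_iff exists_eq_supNorm)
open Summit.QuantumFields.BalabanUV.Beta.FP.HorizontalBookkeepingTail (supNorm_le_add_of_box)
open Summit.QuantumFields.BalabanUV.Beta.FP.ExpLocalisedBubble
open Summit.QuantumFields.BalabanUV.Beta.FP.FarRegionSmear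

/-! ## §1 Real lemmas: the four terms of the truncated engine against the shape factor -/

section RealLemmas

/-- [folklore] `x^p · e^{−κx} ≤ p!/κ^p` for `x ≥ 0`, `κ > 0` (`Real.pow_div_factorial_le_exp` at `κx`). -/
theorem pow_mul_exp_neg_le {κ x : ℝ} (hκ : 0 < κ) (hx : 0 ≤ x) (p : ℕ) :
    x ^ p * Real.exp (-κ * x) ≤ (p.factorial : ℝ) / κ ^ p := by
  have h := Real.pow_div_factorial_le_exp (κ * x) (by positivity) p
  have hp : (0 : ℝ) < p.factorial := by exact_mod_cast Nat.factorial_pos p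
  rw [div_le_iff₀ hp, mul_pow] at h
  have hex := Real.exp_pos (κ * x)
  rw [le_div_iff₀ (pow_pos hκ p), show -κ * x = -(κ * x) by ring, Real.exp_neg]
  have e : x ^ p * (Real.exp (κ * x))⁻¹ * κ ^ p = κ ^ p * x ^ p / Real.exp (κ * x) := by
    rw [div_eq_mul_inv]; ring
  rw [e, div_le_iff₀ hex]
  calc κ ^ p * x ^ p ≤ Real.exp (κ * x) * p.factorial := h
    _ = (p.factorial : ℝ) * Real.exp (κ * x) := mul_comm _ _

variable {s ρ n E E' u v A Θ : ℝ} {a : ℕ}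

/-- [folklore] `1/ρ² ≤ 64/s²` when `0 < s ≤ 8ρ`. -/
theorem inv_sq_le (hs : 0 < s) (hρ : s ≤ 8 * ρ) : 1 / ρ ^ 2 ≤ 64 / s ^ 2 := by
  have hρ0 : 0 < ρ := by linarith
  rw [div_le_div_iff₀ (by positivity) (by positivity), one_mul]
  have := mul_le_mul hρ hρ hs.le (by positivity)
  nlinarith [this]

/-- [folklore] (B0) the outer-sup term: `2·(A·(2/s)^a·E)·Θ/ρ² ≤ 128·2^a·A·Θ·(E·u/s^{a+2})` (`s ≤ 8ρ`, `1 ≤ u`). -/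
theorem termB0_le (hs : 0 < s) (hρ : s ≤ 8 * ρ) (hA : 0 ≤ A) (hΘ : 0 ≤ Θ) (hE : 0 ≤ E) (hu : 1 ≤ u) :
    2 * (A * (2 / s) ^ a * E) * Θ / ρ ^ 2 ≤ 128 * 2 ^ a * A * Θ * (E * u / s ^ (a + 2)) := by
  have h1 := inv_sq_le hs hρ
  have e1 : 2 * (A * (2 / s) ^ a * E) * Θ / ρ ^ 2 = (2 * 2 ^ a * A * Θ * E / s ^ a) * (1 / ρ ^ 2) := by
    rw [div_pow]; ring
  have e2 : (2 * 2 ^ a * A * Θ * E / s ^ a) * (64 / s ^ 2) = 128 * 2 ^ a * A * Θ * (E * 1 / s ^ (a + 2)) := by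
    rw [pow_add]; field_simp; ring
  rw [e1]
  calc (2 * 2 ^ a * A * Θ * E / s ^ a) * (1 / ρ ^ 2) ≤ (2 * 2 ^ a * A * Θ * E / s ^ a) * (64 / s ^ 2) :=
        mul_le_mul_of_nonneg_left h1 (by positivity)
    _ = 128 * 2 ^ a * A * Θ * (E * 1 / s ^ (a + 2)) := e2
    _ ≤ 128 * 2 ^ a * A * Θ * (E * u / s ^ (a + 2)) := by
        refine mul_le_mul_of_nonneg_left (div_le_div_of_nonneg_right ?_ (by positivity)) (by positivity)
        exact mul_le_mul_of_nonneg_left hu hE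

/-- [folklore] (B1) the first-difference term: `(A/s^{a+1}·(E′·v))·Θ/ρ² ≤ 64·A·Θ·(E·u/s^{a+2})` (`s ≤ 8ρ`, `1 ≤ s`, `E′ ≤ E`, `0 ≤ v ≤ u`). -/
theorem termB1_le (hs : 1 ≤ s) (hρ : s ≤ 8 * ρ) (hA : 0 ≤ A) (hΘ : 0 ≤ Θ) (hE' : 0 ≤ E') (hEE : E' ≤ E) (hv : 0 ≤ v) (hvu : v ≤ u) :
    (A / s ^ (a + 1) * (E' * v)) * Θ / ρ ^ 2 ≤ 64 * A * Θ * (E * u / s ^ (a + 2)) := by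
  have hs0 : 0 < s := by linarith
  have h1 := inv_sq_le hs0 hρ
  have e1 : (A / s ^ (a + 1) * (E' * v)) * Θ / ρ ^ 2 = (A * Θ * (E' * v) / s ^ (a + 1)) * (1 / ρ ^ 2) := by ring
  have e2 : (A * Θ * (E' * v) / s ^ (a + 1)) * (64 / s ^ 2) = 64 * A * Θ * (E' * v / s ^ (a + 2)) * (1 / s) := by
    field_simp
    ring
  rw [e1]
  have h1s : 1 / s ≤ 1 := by rw [div_le_one hs0]; exact hs
  calc (A * Θ * (E' * v) / s ^ (a + 1)) * (1 / ρ ^ 2) ≤ (A * Θ * (E' * v) / s ^ (a + 1)) * (64 / s ^ 2) :=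
        mul_le_mul_of_nonneg_left h1 (by positivity)
    _ = 64 * A * Θ * (E' * v / s ^ (a + 2)) * (1 / s) := e2
    _ ≤ 64 * A * Θ * (E' * v / s ^ (a + 2)) * 1 := mul_le_mul_of_nonneg_left h1s (by positivity)
    _ ≤ 64 * A * Θ * (E * u / s ^ (a + 2)) := by
        rw [mul_one]
        refine mul_le_mul_of_nonneg_left (div_le_div_of_nonneg_right ?_ (by positivity)) (by positivity)
        exact mul_le_mul hEE hvu hv (hE'.trans hEE)

/-- [folklore] (B2) the box term is an identity: `20·(A·(4/(3s))^{a+2}·(E·((5/4)w)²))·Θ = 20·(4/3)^{a+2}·(25/16)·A·Θ·(E·w²/s^{a+2})`. -/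
theorem termB2_eq (hs : 0 < s) (w : ℝ) :
    (4 : ℝ) * ((4 : ℝ) + 1) * (A * (4 / (3 * s)) ^ (a + 2) * (E * ((5 / 4 : ℝ) * w) ^ 2)) * Θ
      = 20 * (4 / 3 : ℝ) ^ (a + 2) * (25 / 16) * A * Θ * (E * w ^ 2 / s ^ (a + 2)) := by
  have e : (4 / (3 * s) : ℝ) = (4 / 3) / s := by field_simp
  rw [e, div_pow, mul_pow]
  field_simp
  ring

/-- [folklore] (Bc) the complement term: `e^{−(δ/2)(s−1)/2} ≤ e^{δ/4}·((a+2)!(8/δ)^{a+2})·(e^{−(m/n)s}·u/s^{a+2})` for `0 < m ≤ δ/8`, `1 ≤ n`, `1 ≤ u`, `0 < s`. -/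
theorem termBc_le {δ m : ℝ} (hδ : 0 < δ) (hm : 0 < m) (hmδ : m ≤ δ / 8) (hn : 1 ≤ n) (hs : 0 < s) (hu : 1 ≤ u) :
    Real.exp (-(δ / 2) * ((s - 1) / 2))
      ≤ Real.exp (δ / 4) * (((a + 2).factorial : ℝ) * (8 / δ) ^ (a + 2)) * (Real.exp (-(m / n) * s) * u / s ^ (a + 2)) := by
  have esplit : Real.exp (-(δ / 2) * ((s - 1) / 2)) = Real.exp (δ / 4) * (Real.exp (-(δ / 8) * s) * Real.exp (-(δ / 8) * s)) := by
    rw [← Real.exp_add, ← Real.exp_add]; congr 1; ring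
  have hpow : Real.exp (-(δ / 8) * s) ≤ ((a + 2).factorial : ℝ) * (8 / δ) ^ (a + 2) / s ^ (a + 2) := by
    have h := pow_mul_exp_neg_le (κ := δ / 8) (by positivity) hs.le (a + 2)
    rw [le_div_iff₀ (by positivity)]
    calc Real.exp (-(δ / 8) * s) * s ^ (a + 2) = s ^ (a + 2) * Real.exp (-(δ / 8) * s) := mul_comm _ _
      _ ≤ ((a + 2).factorial : ℝ) / (δ / 8) ^ (a + 2) := h
      _ = ((a + 2).factorial : ℝ) * (8 / δ) ^ (a + 2) := by rw [div_eq_mul_inv, ← inv_pow, inv_div]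
  have hrate : Real.exp (-(δ / 8) * s) ≤ Real.exp (-(m / n) * s) * u := by
    have hn0 : (0 : ℝ) < n := by linarith
    have hmn : m / n ≤ m := div_le_self hm.le hn
    have h1 : Real.exp (-(δ / 8) * s) ≤ Real.exp (-(m / n) * s) := Real.exp_le_exp.mpr (by
      have : m / n * s ≤ δ / 8 * s := mul_le_mul_of_nonneg_right (hmn.trans hmδ) hs.le
      linarith)
    calc Real.exp (-(δ / 8) * s) ≤ Real.exp (-(m / n) * s) * 1 := by rw [mul_one]; exact h1
      _ ≤ Real.exp (-(m / n) * s) * u := mul_le_mul_of_nonneg_left hu (Real.exp_pos _).le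
  rw [esplit, mul_assoc (Real.exp (δ / 4))]
  refine mul_le_mul_of_nonneg_left ?_ (Real.exp_pos _).le
  calc Real.exp (-(δ / 8) * s) * Real.exp (-(δ / 8) * s)
      ≤ (((a + 2).factorial : ℝ) * (8 / δ) ^ (a + 2) / s ^ (a + 2)) * (Real.exp (-(m / n) * s) * u) :=
        mul_le_mul hpow hrate (Real.exp_pos _).le (by positivity)
    _ = _ := by ring

end RealLemmas

/-! ## §2 The graded outer constants and the far estimate at `‖z‖∞ ≥ 8` -/

section Graded

variable {c : Pt × Pt → ℝ} {H : Pt → ℝ} {C δ Ag A₀ A₁ A₂ η m : ℝ} {n a : ℕ}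

/-- [folklore] OUTER CONSTANT: the graded order-0 datum beyond `‖z‖∞/2` gives `|H t| ≤ A₀·(2/‖z‖∞)^a·e^{−(η/2/n)‖z‖∞}` on the outer region. -/
theorem outer0_of_graded (hA0 : 0 ≤ A₀) (hη : 0 < η)
    (hG0 : ∀ t : Pt, 0 < supNorm t → |H t| ≤ A₀ / (supNorm t : ℝ) ^ a * Real.exp (-(η / n) * supNorm t))
    {z : Pt} (hz : 1 ≤ supNorm z) (t : Pt) (ht : supNorm z ≤ 2 * supNorm t) :
    |H t| ≤ A₀ * (2 / (supNorm z : ℝ)) ^ a * Real.exp (-(η / 2 / n) * supNorm z) := by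
  have hupos : 0 < supNorm t := by omega
  have hu0 : (0 : ℝ) < supNorm t := by exact_mod_cast hupos
  have hs0 : (0 : ℝ) < supNorm z := by exact_mod_cast (show 0 < supNorm z by omega)
  have hu2 : (supNorm z : ℝ) ≤ 2 * (supNorm t : ℝ) := by exact_mod_cast ht
  have hn : (0 : ℝ) ≤ n := Nat.cast_nonneg n
  refine (hG0 t hupos).trans ?_
  have h1 : A₀ / (supNorm t : ℝ) ^ a ≤ A₀ * (2 / (supNorm z : ℝ)) ^ a := by
    rw [div_eq_mul_inv, ← inv_pow]
    refine mul_le_mul_of_nonneg_left (pow_le_pow_left₀ (by positivity) ?_ a) hA0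
    rw [inv_eq_one_div, div_le_div_iff₀ hu0 hs0]; linarith
  have h2 : Real.exp (-(η / n) * supNorm t) ≤ Real.exp (-(η / 2 / n) * supNorm z) := by
    refine Real.exp_le_exp.mpr ?_
    have : η / 2 / n * (supNorm z : ℝ) ≤ η / n * (supNorm t : ℝ) := by
      rw [show η / 2 / (n : ℝ) * (supNorm z : ℝ) = η / n * ((supNorm z : ℝ) / 2) by ring]
      exact mul_le_mul_of_nonneg_left (by linarith) (div_nonneg hη.le hn)
    linarith
  exact mul_le_mul h1 h2 (Real.exp_pos _).le (by positivity)

/-- [folklore] BOX CONSTANT: on the coordinate box of radius `⌊‖z‖∞/4⌋` around `z` (`‖z‖∞ ≥ 8`) the graded order-2 datum gives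
`|Δ_iΔ_jH t| ≤ A₂·(4/(3‖z‖∞))^{a+2}·e^{−(η/2/n)‖z‖∞}·((5/4)(1+‖z‖∞/n))²`. -/
theorem box2_of_graded (hA2 : 0 ≤ A₂) (hη : 0 < η) (hn : 1 ≤ n)
    (hG2 : ∀ t : Pt, 0 < supNorm t → ∀ i j, |Δ_[(Pi.single i 1 : Pt)] (Δ_[(Pi.single j 1 : Pt)] H) t|
      ≤ A₂ / (supNorm t : ℝ) ^ (a + 2) * (Real.exp (-(η / n) * supNorm t) * (1 + (supNorm t : ℝ) / n) ^ 2))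
    {z : Pt} (hz : 8 ≤ supNorm z) (t : Pt) (ht : ∀ i, |t i - z i| ≤ ((supNorm z / 4 : ℕ) : ℤ)) (i j : Fin 4) :
    |Δ_[(Pi.single i 1 : Pt)] (Δ_[(Pi.single j 1 : Pt)] H) t|
      ≤ A₂ * (4 / (3 * (supNorm z : ℝ))) ^ (a + 2)
          * (Real.exp (-(η / 2 / n) * supNorm z) * ((5 / 4 : ℝ) * (1 + (supNorm z : ℝ) / n)) ^ 2) := by
  have hlo := supNorm_le_add_of_box ht
  have hhi := supNorm_le_add_of_box (t := z) (y := t) (ρ := supNorm z / 4) fun k => by rw [abs_sub_comm]; exact ht k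
  have hu34 : 3 * (supNorm z : ℝ) ≤ 4 * (supNorm t : ℝ) := by exact_mod_cast (show 3 * supNorm z ≤ 4 * supNorm t by omega)
  have hu54 : 4 * (supNorm t : ℝ) ≤ 5 * (supNorm z : ℝ) := by exact_mod_cast (show 4 * supNorm t ≤ 5 * supNorm z by omega)
  have hupos : 0 < supNorm t := by omega
  have hu0 : (0 : ℝ) < supNorm t := by exact_mod_cast hupos
  have hs0 : (0 : ℝ) < supNorm z := by exact_mod_cast (show 0 < supNorm z by omega)
  have hn' : (0 : ℝ) < n := by exact_mod_cast hn
  refine (hG2 t hupos i j).trans ?_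
  have h1 : A₂ / (supNorm t : ℝ) ^ (a + 2) ≤ A₂ * (4 / (3 * (supNorm z : ℝ))) ^ (a + 2) := by
    rw [div_eq_mul_inv, ← inv_pow]
    refine mul_le_mul_of_nonneg_left (pow_le_pow_left₀ (by positivity) ?_ (a + 2)) hA2
    rw [inv_eq_one_div, div_le_div_iff₀ hu0 (by positivity)]; linarith
  have h2 : Real.exp (-(η / n) * supNorm t) ≤ Real.exp (-(η / 2 / n) * supNorm z) := by
    refine Real.exp_le_exp.mpr ?_
    have : η / 2 / n * (supNorm z : ℝ) ≤ η / n * (supNorm t : ℝ) := by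
      rw [show η / 2 / (n : ℝ) * (supNorm z : ℝ) = η / n * ((supNorm z : ℝ) / 2) by ring]
      exact mul_le_mul_of_nonneg_left (by linarith) (div_nonneg hη.le hn'.le)
    linarith
  have h3 : (1 + (supNorm t : ℝ) / n) ^ 2 ≤ ((5 / 4 : ℝ) * (1 + (supNorm z : ℝ) / n)) ^ 2 := by
    refine pow_le_pow_left₀ (by positivity) ?_ 2
    have h4 : (supNorm t : ℝ) / n ≤ (5 / 4) * ((supNorm z : ℝ) / n) := by
      rw [show (5 / 4 : ℝ) * ((supNorm z : ℝ) / n) = (5 * (supNorm z : ℝ) / 4) / n by ring]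
      exact div_le_div_of_nonneg_right (by linarith) hn'.le
    have h5 : 0 ≤ (supNorm z : ℝ) / n := div_nonneg hs0.le hn'.le
    linarith
  exact mul_le_mul h1 (mul_le_mul h2 h3 (by positivity) (Real.exp_pos _).le) (by positivity) (by positivity)

/-- [folklore] **THE GRADED FAR SHAPE AT A FAR POINT** (`‖z‖∞ ≥ 8`).  Weight `|c(x,y)| ≤ C·e^{−δ(|x|₁+|y|₁)}` with ZERO mass and ZERO first moments; kernel `|H| ≤ Ag`
with, for `t ≠ 0`, the scale-`n` GRADED data `|H t| ≤ A₀‖t‖∞^{−a}e^{−(η/n)‖t‖∞}`, `|Δ_iH t| ≤ A₁‖t‖∞^{−a−1}e^{−(η/n)‖t‖∞}(1+‖t‖∞/n)`,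
`|Δ_iΔ_jH t| ≤ A₂‖t‖∞^{−a−2}e^{−(η/n)‖t‖∞}(1+‖t‖∞/n)²`; rate `0 < m ≤ min(η/2, δ/8)` ⟹
`|Σ' c·H(z+x−y)| ≤ K₈·(e^{−(m/n)‖z‖∞}(1+‖z‖∞/n)²/‖z‖∞^{a+2})`,
`K₈ := C·(20(4/3)^{a+2}(25/16)·A₂·Θ₂ + 128·2^a·A₀·Θ₂ + 64·A₁·Θ₃) + Ag·C·Zl(δ/2)²·e^{δ/4}·((a+2)!(8/δ)^{a+2})`. -/
theorem abs_smear_le_of_graded_far (hδ : 0 < δ)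
    (hc : ∀ p : Pt × Pt, |c p| ≤ C * (Real.exp (-δ * l1 p.1) * Real.exp (-δ * l1 p.2)))
    (hmass : ∑' p : Pt × Pt, c p = 0) (hmom : ∀ i, ∑' p : Pt × Pt, c p * ((p.1 - p.2) i : ℝ) = 0)
    (hg : ∀ t, |H t| ≤ Ag) (hn : 1 ≤ n) (hη : 0 < η) (hA0 : 0 ≤ A₀) (hA1 : 0 ≤ A₁) (hA2 : 0 ≤ A₂)
    (hG0 : ∀ t : Pt, 0 < supNorm t → |H t| ≤ A₀ / (supNorm t : ℝ) ^ a * Real.exp (-(η / n) * supNorm t))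
    (hG1 : ∀ t : Pt, 0 < supNorm t → ∀ i, |Δ_[(Pi.single i 1 : Pt)] H t|
      ≤ A₁ / (supNorm t : ℝ) ^ (a + 1) * (Real.exp (-(η / n) * supNorm t) * (1 + (supNorm t : ℝ) / n)))
    (hG2 : ∀ t : Pt, 0 < supNorm t → ∀ i j, |Δ_[(Pi.single i 1 : Pt)] (Δ_[(Pi.single j 1 : Pt)] H) t|
      ≤ A₂ / (supNorm t : ℝ) ^ (a + 2) * (Real.exp (-(η / n) * supNorm t) * (1 + (supNorm t : ℝ) / n) ^ 2))
    (hm : 0 < m) (hmη : m ≤ η / 2) (hmδ : m ≤ δ / 8) {z : Pt} (hz : 8 ≤ supNorm z) :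
    |∑' p : Pt × Pt, c p * H (z + p.1 - p.2)|
      ≤ (C * (20 * (4 / 3 : ℝ) ^ (a + 2) * (25 / 16) * A₂ * (2 ^ (2 + 1) * (((2 : ℕ).factorial : ℝ) * Real.exp (δ / 2) * (2 / δ) ^ 2) * Real.exp (δ / 2) * Zl 4 (δ / 2) ^ 2)
              + 128 * 2 ^ a * A₀ * (2 ^ (2 + 1) * (((2 : ℕ).factorial : ℝ) * Real.exp (δ / 2) * (2 / δ) ^ 2) * Real.exp (δ / 2) * Zl 4 (δ / 2) ^ 2)
              + 64 * A₁ * (2 ^ (2 + 1 + 1) * (((2 + 1).factorial : ℝ) * Real.exp (δ / 2) * (2 / δ) ^ (2 + 1)) * Real.exp (δ / 2) * Zl 4 (δ / 2) ^ 2))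
          + Ag * C * Zl 4 (δ / 2) ^ 2 * (Real.exp (δ / 4) * (((a + 2).factorial : ℝ) * (8 / δ) ^ (a + 2))))
        * (Real.exp (-(m / n) * supNorm z) * (1 + (supNorm z : ℝ) / n) ^ 2 / (supNorm z : ℝ) ^ (a + 2)) := by
  have hC := nonneg_of_loc hc
  have hAg : 0 ≤ Ag := (abs_nonneg _).trans (hg z)
  have hZ : 0 < Zl 4 (δ / 2) := Zl_pos (half_pos hδ)
  have hn' : (0 : ℝ) < n := by exact_mod_cast hn
  have hs8 : (8 : ℝ) ≤ (supNorm z : ℝ) := by exact_mod_cast hz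
  have hs0 : (0 : ℝ) < (supNorm z : ℝ) := by linarith
  have hρ8 : (supNorm z : ℝ) ≤ 8 * (((supNorm z / 4 : ℕ) : ℕ) : ℝ) := by
    exact_mod_cast (show supNorm z ≤ 8 * (supNorm z / 4) by omega)
  have hsn : 0 ≤ (supNorm z : ℝ) / n := div_nonneg hs0.le hn'.le
  have hu : (1 : ℝ) ≤ (1 + (supNorm z : ℝ) / n) ^ 2 := one_le_pow₀ (by linarith)
  -- the truncated engine with the graded outer constants, `k := 2`
  have hmain := abs_smear_sub_order1_le_far hδ hc hg hz (by positivity) (by positivity) 2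
    (outer0_of_graded hA0 hη hG0 (by omega)) (fun i => hG1 z (by omega) i) (box2_of_graded hA2 hη hn hG2 hz)
  simp only [hmass, hmom, zero_mul, sub_zero, Finset.sum_const_zero] at hmain
  refine hmain.trans ?_
  -- the four terms against the shape factor
  set Θ₂ : ℝ := 2 ^ (2 + 1) * (((2 : ℕ).factorial : ℝ) * Real.exp (δ / 2) * (2 / δ) ^ 2) * Real.exp (δ / 2) * Zl 4 (δ / 2) ^ 2 with hΘ₂
  set Θ₃ : ℝ := 2 ^ (2 + 1 + 1) * (((2 + 1).factorial : ℝ) * Real.exp (δ / 2) * (2 / δ) ^ (2 + 1)) * Real.exp (δ / 2) * Zl 4 (δ / 2) ^ 2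
    with hΘ₃
  have hΘ₂0 : 0 ≤ Θ₂ := by positivity
  have hΘ₃0 : 0 ≤ Θ₃ := by positivity
  have hEE : Real.exp (-(η / n) * (supNorm z : ℝ)) ≤ Real.exp (-(η / 2 / n) * (supNorm z : ℝ)) :=
    Real.exp_le_exp.mpr (by
      have : 0 ≤ η / 2 / n * (supNorm z : ℝ) := by positivity
      have e : η / (n : ℝ) * (supNorm z : ℝ) = 2 * (η / 2 / n * (supNorm z : ℝ)) := by ring
      linarith)
  have hEΨ : Real.exp (-(η / 2 / n) * (supNorm z : ℝ)) ≤ Real.exp (-(m / n) * (supNorm z : ℝ)) :=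
    Real.exp_le_exp.mpr (by
      have : m / n * (supNorm z : ℝ) ≤ η / 2 / n * (supNorm z : ℝ) :=
        mul_le_mul_of_nonneg_right (div_le_div_of_nonneg_right hmη hn'.le) hs0.le
      linarith)
  have hv : (1 + (supNorm z : ℝ) / n) ≤ (1 + (supNorm z : ℝ) / n) ^ 2 := by nlinarith
  have hB0 := termB0_le (a := a) (Θ := Θ₂) (E := Real.exp (-(η / 2 / n) * (supNorm z : ℝ))) hs0 hρ8 hA0 hΘ₂0 (Real.exp_pos _).le hu
  have hB1 := termB1_le (a := a) (Θ := Θ₃) ((by norm_num : (1 : ℝ) ≤ 8).trans hs8) hρ8 hA1 hΘ₃0 (Real.exp_pos _).le hEE (by linarith) hv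
  have hB2 := termB2_eq (a := a) (A := A₂) (Θ := Θ₂) (E := Real.exp (-(η / 2 / n) * (supNorm z : ℝ))) hs0 (1 + (supNorm z : ℝ) / n)
  have hBc := termBc_le (a := a) (n := (n : ℝ)) hδ hm hmδ (by exact_mod_cast hn) hs0 hu
  -- monotonicity of the shape factor in the rate
  set Ψ : ℝ := Real.exp (-(m / n) * (supNorm z : ℝ)) * (1 + (supNorm z : ℝ) / n) ^ 2 / (supNorm z : ℝ) ^ (a + 2) with hΨ
  have hΦΨ : Real.exp (-(η / 2 / n) * (supNorm z : ℝ)) * (1 + (supNorm z : ℝ) / n) ^ 2 / (supNorm z : ℝ) ^ (a + 2) ≤ Ψ :=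
    div_le_div_of_nonneg_right (mul_le_mul_of_nonneg_right hEΨ (by positivity)) (by positivity)
  have hΨ0 : 0 ≤ Ψ := by positivity
  have hsum : C * ((4 : ℝ) * ((4 : ℝ) + 1) * (A₂ * (4 / (3 * (supNorm z : ℝ))) ^ (a + 2)
        * (Real.exp (-(η / 2 / n) * supNorm z) * ((5 / 4 : ℝ) * (1 + (supNorm z : ℝ) / n)) ^ 2)) * Θ₂
        + (2 * (A₀ * (2 / (supNorm z : ℝ)) ^ a * Real.exp (-(η / 2 / n) * supNorm z)) * Θ₂
            + A₁ / (supNorm z : ℝ) ^ (a + 1) * (Real.exp (-(η / n) * supNorm z) * (1 + (supNorm z : ℝ) / n)) * Θ₃)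
          / (((supNorm z / 4 : ℕ) : ℕ) : ℝ) ^ 2)
      ≤ C * ((20 * (4 / 3 : ℝ) ^ (a + 2) * (25 / 16) * A₂ * Θ₂ + 128 * 2 ^ a * A₀ * Θ₂ + 64 * A₁ * Θ₃) * Ψ) := by
    rw [add_div, hB2]
    have h3 := add_le_add (le_of_eq rfl : 20 * (4 / 3 : ℝ) ^ (a + 2) * (25 / 16) * A₂ * Θ₂
        * (Real.exp (-(η / 2 / n) * (supNorm z : ℝ)) * (1 + (supNorm z : ℝ) / n) ^ 2 / (supNorm z : ℝ) ^ (a + 2)) ≤ _) (add_le_add hB0 hB1)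
    refine (mul_le_mul_of_nonneg_left h3 hC).trans ?_
    rw [show ∀ X Y Z Φ : ℝ, X * Φ + (Y * Φ + Z * Φ) = (X + Y + Z) * Φ from fun X Y Z Φ => by ring]
    exact mul_le_mul_of_nonneg_left (mul_le_mul_of_nonneg_left hΦΨ (by positivity)) hC
  have hcomp : Ag * C * Real.exp (-(δ / 2) * (((supNorm z : ℝ) - 1) / 2)) * Zl 4 (δ / 2) ^ 2
      ≤ Ag * C * Zl 4 (δ / 2) ^ 2 * (Real.exp (δ / 4) * (((a + 2).factorial : ℝ) * (8 / δ) ^ (a + 2))) * Ψ := by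
    calc Ag * C * Real.exp (-(δ / 2) * (((supNorm z : ℝ) - 1) / 2)) * Zl 4 (δ / 2) ^ 2
        = Ag * C * Zl 4 (δ / 2) ^ 2 * Real.exp (-(δ / 2) * (((supNorm z : ℝ) - 1) / 2)) := by ring
      _ ≤ Ag * C * Zl 4 (δ / 2) ^ 2 * (Real.exp (δ / 4) * (((a + 2).factorial : ℝ) * (8 / δ) ^ (a + 2)) * Ψ) :=
          mul_le_mul_of_nonneg_left hBc (by positivity)
      _ = _ := by ring
  calc _ ≤ C * ((20 * (4 / 3 : ℝ) ^ (a + 2) * (25 / 16) * A₂ * Θ₂ + 128 * 2 ^ a * A₀ * Θ₂ + 64 * A₁ * Θ₃) * Ψ)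
        + Ag * C * Zl 4 (δ / 2) ^ 2 * (Real.exp (δ / 4) * (((a + 2).factorial : ℝ) * (8 / δ) ^ (a + 2))) * Ψ := add_le_add hsum hcomp
    _ = _ := by rw [hΨ]; ring

end Graded

end Summit.QuantumFields.BalabanUV.Beta.FP.FarRegionSmearGraded

end
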